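import Summits.BirchSwinnertonDyer.BirchSwinnertonDyer.Theorems.ResidualThetaTransportAtTwoResidualSignedLambdaLowerCMAtTwoLayerPairingOfFunNondegenerate
import Literature.NumberTheory.GaloisRepresentations.ContinuousShapiroLiftUnit
import Literature.NumberTheory.GaloisRepresentations.CoinducedDiscreteGaloisModuleProofs
import HarnessLib

/-!
# Greenberg LNM 1716 Lemma 4.6 on `Γ`-invariants (H46), kernel road C′, brick B4b: the OBSTRUCTION TERM of the levelwise
# Poitou–Tate call at the auxiliary place is the level-`0` local Tate pairing against the CORESTRICTION —
# `⟨u_* z̃, loc_v (Ψ Sh b)⟩_v = inv_v(z̃ ∪_B loc_v(cor b))`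

Cell `bsd-2adic` (run/shared/lean/pub/bsd-2adic/), seat `bsd-2adic-tower-1` GEN 34; `--supports stmt-BirchSwinnertonDyer-19271` (helper).
THEOREMS ONLY (no definition, no named fact, no instance declaration, no `sorry`); closes no item; nothing booked; BSD is not
proved by any of this. Companion of `…TorsionEulerCharH46Levelwise` (B4: the `SelmerComplement` call with the H46 Selmer structures,
whose orthogonality hypothesis `hT` is the `S₀`-sum of the terms computed here) and of the Literature bricks
`GaloisRepresentations/ContinuousShapiroLiftUnit` (B1: `ContPairing.cupProduct_const_map_shapiroLift`,
`⟨u_* a', θ^*(Sh b)⟩_{ΣP} = ⟨a', θ^*(cor b)⟩_P`) and `CoinducedDiscreteGaloisModuleProofs` (`localization_cohomologyMap_coindTateDualMor`).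

For a number field `K`, a finite discrete `Γ_K`-module `M` with an equivariant pairing `B : M × M → μ_n`, an open `U ≤ Γ_K` of finite
index (`ρc := Maps(Γ_K ⧸ U, M)`, `Ψ := coindTateDualMor`, `Sh := shapiroLift`), a place `v`, a family of invariant maps `inv`, a LOCAL
class `z' ∈ H¹(K_v, M)` and a LAYER class `b ∈ H¹(U, M)`:

* `localTatePairingZMod_unit_coindTateDual_shapiroLift` — for any unit `u_v : M|_{Γ_{K_v}} ⟶ ρc|_{Γ_{K_v}}` (constant functions):
  `localTatePairingZMod ρc n v (inv v) (H¹(u_v) z') (loc_v (H¹(Ψ)(Sh b))) = inv v (z' ∪_{B|_{Γ_{K_v}}} loc_v (cores b))` — the tree's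
  `ThetaTransport.LayerPairingNondegenerate.localTatePairing_coind_cohomologyMap_eq_cupProduct_restrict` (the local Tate pairing through
  `Ψ` is the restricted summed cup product) followed by B1 with the trace `r_v` (restriction of `ContinuousRep.coindOpenTrace`).

In the H46 programme (`K = ℚ`, `M = E[p^N]`, `B` = Weil, `v = v₀` good auxiliary, `U = Γ_n`, `z' = z̃` the lift of the target class
`z ∈ H¹(ℚ_{v₀}, E)[p^j]`): the orthogonality input of B4 is `inv_{v₀}(z̃ ∪_e loc_{v₀}(cor b)) = 0` for the ♭-Selmer layer classes `b`
— the pairing of `z` with the NORM of a layer Selmer class, killed by the universal-norm brick B6.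

References: [NeukirchSchmidtWingberg2008] I §5 Prop. (1.5.3)(iv), I §6 (1.6.4); [MilneADT2006] I Cor. 2.3, I §6 (proof of Prop. 6.9);
[GreenbergLNM1716] §4 Lemma 4.6 (p. 105), Lemma 4.7 (p. 108).
-/

set_option autoImplicit false
-- the Theorems namespace of this sub repeats the summit name by design (D-0017 nested layout)
set_option linter.dupNamespace false

noncomputable section

open scoped Classical

universe u

namespace Summit.BirchSwinnertonDyer.BirchSwinnertonDyer.Theorems

namespace TorsionEulerChar.H46Obstruction

open CategoryTheory Field NumberField IsDedekindDomain
  Literature.NumberTheory.GaloisRepresentations Literature.NumberTheory.GaloisRepresentations.DiscreteGaloisModule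
  Literature.NumberTheory.GaloisCohomology
open _root_.TopRep _root_.ContinuousCohomology
open ThetaTransport.LayerPairingNondegenerate (localTatePairing_coind_cohomologyMap_eq_cupProduct_restrict)

variable {K : Type u} [Field K] [NumberField K] {M : Type u} [AddCommGroup M] [TopologicalSpace M] [DiscreteTopology M]
  [Finite M] (ρ : DiscreteGaloisModule K M)
  (U : Subgroup (absoluteGaloisGroup K)) [Fintype (absoluteGaloisGroup K ⧸ U)]
  (hU : IsOpen (U : Set (absoluteGaloisGroup K))) {s : absoluteGaloisGroup K ⧸ U → absoluteGaloisGroup K}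
  (hs : ∀ x, (s x : absoluteGaloisGroup K ⧸ U) = x) (hs1 : s ((1 : absoluteGaloisGroup K) : absoluteGaloisGroup K ⧸ U) = 1)
  {n : ℕ} (B : M →+ M →+ MuCarrier K n)
  (hB : ∀ (σ : absoluteGaloisGroup K) (m m' : M), B (ρ σ m) (ρ σ m') = mu K n σ (B m m'))
  (v : Place K) (inv : LocalInvariants K n)

/-- **The obstruction term at the auxiliary place is the local Tate pairing against the corestriction.** For a unit
`u_v : M|_{Γ_{K_v}} ⟶ Maps(Γ_K ⧸ U, M)|_{Γ_{K_v}}` (`(u_v x)(y) = x`), a local class `z' ∈ H¹(K_v, M)` and a layer class `b ∈ H¹(U, M)`: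
`localTatePairingZMod ρc n v (inv v) (H¹(u_v) z') (loc_v (H¹(Ψ)(Sh b))) = inv v (z' ∪_{B|} loc_v (cores b))`, where `ρc = Maps(Γ_K ⧸ U, M)`,
`Ψ = coindTateDualMor ρ ρ U B`, `Sh = shapiroLift`, `cores` the corestriction `H¹(U, M) → H¹(Γ_K, M)`, and `loc_v` on the right is the
restriction along `Γ_{K_v} → Γ_K` (`ContinuousCohomology.map … (𝟙 _)`). Proof: the local Tate pairing through `Ψ` is the restricted summed cup
product (`localTatePairing_coind_cohomologyMap_eq_cupProduct_restrict`), then the unit/trace adjunction and `r_* θ^*(Sh b) = θ^*(cores b)`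
(`ContPairing.cupProduct_const_map_shapiroLift`, trace = restriction of `ContinuousRep.coindOpenTrace`).
[cite: NeukirchSchmidtWingberg2008, I §5 Prop. (1.5.3)(iv), I §6 Prop. (1.6.4)] [cite: MilneADT2006, Ch. I Cor. 2.3] -/
theorem localTatePairingZMod_unit_coindTateDual_shapiroLift [CompactSpace (absoluteGaloisGroup K)]
    [CompactSpace (absoluteGaloisGroup (Place.Completion v))]
    (uθ : TopRep.res (absGaloisRestrict K (Place.Completion v) : absoluteGaloisGroup (Place.Completion v) →* absoluteGaloisGroup K)
        ρ.toTopRep ⟶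
      TopRep.res (absGaloisRestrict K (Place.Completion v) : absoluteGaloisGroup (Place.Completion v) →* absoluteGaloisGroup K)
        (coindFin.{0, u} ρ.toTopRep U))
    (hu : ∀ (x : M) (y : absoluteGaloisGroup K ⧸ U), (uθ.hom x : absoluteGaloisGroup K ⧸ U → M) y = x)
    (z' : continuousCohomology.{0, u, u} 1
      (TopRep.res (absGaloisRestrict K (Place.Completion v) : absoluteGaloisGroup (Place.Completion v) →* absoluteGaloisGroup K)
        ρ.toTopRep))
    (b : continuousCohomology 1 (subgroupRep ρ.toTopRep U)) :
    localTatePairingZMod (ρ.coind U hU) n v (inv v) (cohomologyMap uθ 1 z')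
        (galoisCohomology.localization ((ρ.coind U hU).tateDual n) v 1
          (cohomologyMap (coindTateDualMor ρ ρ U B hU hB) 1 (shapiroLift ρ.toTopRep U hU hs hs1 b))) =
      inv v (((pairing ρ ρ (mu K n) B hB).restrict (absGaloisRestrict K (Place.Completion v))).cupProduct z'
        (ContinuousCohomology.map (absGaloisRestrict K (Place.Completion v))
          (𝟙 (TopRep.res (absGaloisRestrict K (Place.Completion v) :
            absoluteGaloisGroup (Place.Completion v) →* absoluteGaloisGroup K) ρ.toTopRep)) 1
          (cores ρ.toTopRep U hU b))) := by
  -- the trace `r : Maps(Γ_K ⧸ U, M) → M`, restricted along `Γ_{K_v} → Γ_K`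
  let rθ : TopRep.res (absGaloisRestrict K (Place.Completion v) : absoluteGaloisGroup (Place.Completion v) →* absoluteGaloisGroup K)
        (coindFin.{0, u} ρ.toTopRep U) ⟶
      TopRep.res (absGaloisRestrict K (Place.Completion v) : absoluteGaloisGroup (Place.Completion v) →* absoluteGaloisGroup K)
        ρ.toTopRep :=
    TopRep.ofHom ⟨(ρ.coindOpenTrace U hU).hom.toContinuousLinearMap, fun d =>
      (ρ.coindOpenTrace U hU).hom.isIntertwining' (absGaloisRestrict K (Place.Completion v) d)⟩
  have hr : ∀ ψ : coindFin.{0, u} ρ.toTopRep U,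
      rθ.hom ψ = ∑ y : absoluteGaloisGroup K ⧸ U, (ψ : absoluteGaloisGroup K ⧸ U → M) y := fun _ => rfl
  rw [localTatePairingZMod_apply, localization_cohomologyMap_coindTateDualMor,
    localTatePairing_coind_cohomologyMap_eq_cupProduct_restrict]
  congr 1
  exact ContPairing.cupProduct_const_map_shapiroLift (pairing ρ ρ (mu K n) B hB) U
    (absGaloisRestrict K (Place.Completion v)) hU hs hs1 uθ hu rθ hr (𝟙 _) (fun _ => rfl) (𝟙 _) (fun _ => rfl) z' b

end TorsionEulerChar.H46Obstruction

end Summit.BirchSwinnertonDyer.BirchSwinnertonDyer.Theorems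

end
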